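import Mathlib.NumberTheory.LegendreSymbol.AddCharacter
import Mathlib.Analysis.Fourier.FiniteAbelian.PontryaginDuality
import Mathlib.Analysis.SpecialFunctions.Complex.Circle
import Mathlib.RingTheory.RootsOfUnity.Complex
import HarnessLib

/-!
# The additive characters of a finite field: `ψ_β(a) = e_p(Tr_{𝔽_q/𝔽_p}(β a))`
(Lidl–Niederreiter Thm. 5.7; the parametrisation `ψ ↔ α` of [KohelShparlinski2000, §1])

For a finite field `F` of characteristic `p` the **canonical additive character** is
`ψ₁(a) = e_p(Tr_{F/𝔽_p}(a))`, `e_p(t) = exp(2πi t/p)` (`traceChar F p`), and every complex additive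
character of `F` is `ψ_β = ψ₁(β ·)` for a unique `β ∈ F` (Lidl–Niederreiter, *Finite Fields*,
Thm. 5.7); `ψ_β` is nontrivial iff `β ≠ 0`. This is the dictionary "`ψ(z) = exp(2πi Tr(αz)/p)`,
`Ψ ≅ 𝔽_q`" of [KohelShparlinski2000, §1, p. 396] by which a nontrivial additive character `ψ`
determines the Artin–Schreier covering `zᵖ - z = α f` carrying the sums `S(ω, ψ, f)`.

* `traceChar F p : AddChar F ℂ`, `traceChar_apply`, **`traceChar_eq_one_iff`**
  (`ψ₁(a) = 1 ↔ Tr(a) = 0`), `traceChar_ne_one`, `isPrimitive_traceChar`;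
* **`traceChar_mulShift_bijective`**: `β ↦ ψ_β` is a bijection `F ≃ Hom(F, ℂ*)` (injective as `ψ₁`
  is primitive, Mathlib `AddChar.to_mulShift_inj_of_isPrimitive`; and `#Hom(F, ℂ*) = #F`, Mathlib
  `AddChar.card_eq`), `exists_eq_mulShift_traceChar`, `mulShift_traceChar_ne_one_iff`;
* **`exists_apply_eq_one_iff_trace_mul`**: for every `ψ` there is `β` (`≠ 0` iff `ψ ≠ 1`) with
  `ψ(a) = 1 ↔ Tr_{F/𝔽_p}(β a) = 0` for all `a` — the form consumed by the place-splitting computation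
  in the Artin–Schreier covering (`FunctionFieldArtinSchreierSplitting`);
* `sum_range_pow_apply`: `Σ_{c < p} ψ(a)^c = p · [ψ(a) = 1]` (orthogonality over the powers
  `ψ^c`, `c ∈ 𝔽_p`, of one character: `ψ(a)` is a `p`-th root of unity).

Everything is proved; the only definition is `traceChar`; no named facts.

## References

* R. Lidl, H. Niederreiter, *Finite Fields*, 2nd ed., Cambridge UP 1997, Thm. 5.7 (all additive
  characters are `ψ_b(c) = ψ₁(bc)`). [LidlNiederreiter1996]
* D. R. Kohel, I. E. Shparlinski, *On exponential sums and group generators for elliptic curves over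
  finite fields*, ANTS-IV, LNCS 1838 (2000), §1 (p. 396). [KohelShparlinski2000]
-/

noncomputable section

open scoped Classical
open Complex

namespace Literature.NumberTheory.GaussSums.FiniteFieldTraceCharacter

variable (F : Type*) [Field F] [Fintype F] (p : ℕ) [hp : Fact p.Prime] [Algebra (ZMod p) F]

/-- The primitive `p`-th root of unity `e_p(1) = exp(2πi/p)`. [folklore] -/
def zeta : ℂ := exp (2 * Real.pi * I / p)

/-- `zeta p` is a primitive `p`-th root of unity. [folklore] -/
theorem isPrimitiveRoot_zeta : IsPrimitiveRoot (zeta p) p :=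
  Complex.isPrimitiveRoot_exp p hp.out.ne_zero

/-- `(zeta p)^p = 1`. [folklore] -/
theorem zeta_pow : zeta p ^ p = 1 := (isPrimitiveRoot_zeta p).pow_eq_one


/-- **The canonical additive character `ψ₁ = e_p ∘ Tr_{F/𝔽_p}`** of a finite field of
characteristic `p` (Lidl–Niederreiter Ch. 5 §1: the "canonical additive character").
[cite: LidlNiederreiter1996, Thm. 5.7] -/
def traceChar : AddChar F ℂ :=
  (AddChar.zmodChar p (zeta_pow p)).compAddMonoidHom (Algebra.trace (ZMod p) F).toAddMonoidHom

omit [Fintype F] in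
/-- `ψ₁(a) = e_p(1)^{Tr(a)}`. [cite: LidlNiederreiter1996, Thm. 5.7] -/
theorem traceChar_apply (a : F) :
    traceChar F p a = zeta p ^ (Algebra.trace (ZMod p) F a).val := by
  rw [traceChar, AddChar.compAddMonoidHom_apply, LinearMap.toAddMonoidHom_coe, AddChar.zmodChar_apply]

omit [Fintype F] in
/-- **`ψ₁(a) = 1 ↔ Tr_{F/𝔽_p}(a) = 0`** (`e_p` is injective on `𝔽_p`). [cite: LidlNiederreiter1996, Thm. 5.7] -/
theorem traceChar_eq_one_iff (a : F) : traceChar F p a = 1 ↔ Algebra.trace (ZMod p) F a = 0 := by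
  rw [traceChar, AddChar.compAddMonoidHom_apply, LinearMap.toAddMonoidHom_coe]
  exact (AddChar.zmodChar_primitive_of_primitive_root p (isPrimitiveRoot_zeta p)).zmod_char_eq_one_iff p _

/-- `ψ₁` is nontrivial (the trace `F → 𝔽_p` is onto). [cite: LidlNiederreiter1996, Thm. 5.7] -/
theorem traceChar_ne_one : traceChar F p ≠ 1 := by
  haveI : FiniteDimensional (ZMod p) F := Module.Finite.of_finite
  obtain ⟨a, ha⟩ := Algebra.trace_surjective (ZMod p) F 1
  rw [AddChar.ne_one_iff]
  refine ⟨a, fun h => ?_⟩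
  rw [traceChar_eq_one_iff, ha] at h
  exact one_ne_zero h

/-- `ψ₁` is primitive: `ψ₁(β ·) ≠ 1` for `β ≠ 0`. [cite: LidlNiederreiter1996, Thm. 5.7] -/
theorem isPrimitive_traceChar : (traceChar F p).IsPrimitive :=
  AddChar.IsPrimitive.of_ne_one (traceChar_ne_one F p)

/-- **`β ↦ ψ_β = ψ₁(β ·)` is a bijection `F → Hom(F, ℂ*)`** (Lidl–Niederreiter Thm. 5.7: these are all
the additive characters, pairwise distinct). [cite: LidlNiederreiter1996, Thm. 5.7] -/
theorem traceChar_mulShift_bijective :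
    Function.Bijective (fun β : F => (traceChar F p).mulShift β) := by
  have hinj : Function.Injective (fun β : F => (traceChar F p).mulShift β) :=
    AddChar.to_mulShift_inj_of_isPrimitive (isPrimitive_traceChar F p)
  refine (Fintype.bijective_iff_injective_and_card _).2 ⟨hinj, ?_⟩
  rw [AddChar.card_eq]

/-- Every additive character of `F` is `ψ_β` for some `β`. [cite: LidlNiederreiter1996, Thm. 5.7] -/
theorem exists_eq_mulShift_traceChar (ψ : AddChar F ℂ) : ∃ β : F, ψ = (traceChar F p).mulShift β := by
  obtain ⟨β, hβ⟩ := (traceChar_mulShift_bijective F p).2 ψ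
  exact ⟨β, hβ.symm⟩

/-- `ψ_β ≠ 1 ↔ β ≠ 0`. [cite: LidlNiederreiter1996, Thm. 5.7] -/
theorem mulShift_traceChar_ne_one_iff (β : F) : (traceChar F p).mulShift β ≠ 1 ↔ β ≠ 0 := by
  constructor
  · rintro h rfl
    exact h (AddChar.mulShift_zero _)
  · intro hβ
    exact isPrimitive_traceChar F p hβ

/-- **The kernel of an additive character is a trace hyperplane**: for every `ψ ∈ Hom(F, ℂ*)` there
is `β ∈ F`, nonzero iff `ψ` is nontrivial, with `ψ(a) = 1 ↔ Tr_{F/𝔽_p}(β a) = 0` for all `a ∈ F`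
(the `α` of `ψ(z) = e_p(Tr(αz))` in [KohelShparlinski2000, §1]).
[cite: KohelShparlinski2000, §1 (p. 396)] [cite: LidlNiederreiter1996, Thm. 5.7] -/
theorem exists_apply_eq_one_iff_trace_mul (ψ : AddChar F ℂ) :
    ∃ β : F, (ψ ≠ 1 ↔ β ≠ 0) ∧ ∀ a : F, ψ a = 1 ↔ Algebra.trace (ZMod p) F (β * a) = 0 := by
  obtain ⟨β, rfl⟩ := exists_eq_mulShift_traceChar F p ψ
  exact ⟨β, mulShift_traceChar_ne_one_iff F p β, fun a => by
    rw [AddChar.mulShift_apply, traceChar_eq_one_iff]⟩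

omit [Fintype F] hp [Algebra (ZMod p) F] in
/-- The values of an additive character of `F` are `p`-th roots of unity: `ψ(a)^p = ψ(p·a) = 1`.
[folklore] -/
theorem apply_pow_eq_one [CharP F p] (ψ : AddChar F ℂ) (a : F) : ψ a ^ p = 1 := by
  rw [← AddChar.map_nsmul_eq_pow, nsmul_eq_mul, CharP.cast_eq_zero F p, zero_mul,
    AddChar.map_zero_eq_one]

omit [Fintype F] hp [Algebra (ZMod p) F] in
/-- **Orthogonality over the powers of one character**: `Σ_{c < p} ψ(a)^c = p` if `ψ(a) = 1` and
`= 0` otherwise (`ψ(a)` is a `p`-th root of unity; geometric sum). This is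
`Σ_{c ∈ 𝔽_p} ψ^c(a) = #𝔽_p · [ψ(a) = 1]`, the orthogonality relation for the cyclic group `⟨ψ⟩`.
[folklore] -/
theorem sum_range_pow_apply [CharP F p] (ψ : AddChar F ℂ) (a : F) :
    ∑ c ∈ Finset.range p, ψ a ^ c = if ψ a = 1 then (p : ℂ) else 0 := by
  split_ifs with h
  · simp [h]
  · have := geom_sum_mul (ψ a) p
    rw [apply_pow_eq_one, sub_self] at this
    exact (mul_eq_zero.mp this).resolve_right (sub_ne_zero.mpr h)

end Literature.NumberTheory.GaussSums.FiniteFieldTraceCharacter
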